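import Summits.QuantumFields.YangMills.Theorems.UnitScaleTiltProp7DivSqOfCombBernsteinRow
import Summits.QuantumFields.YangMills.Theorems.UnitScaleTiltProp7CombCompetitorPullback
import Summits.QuantumFields.YangMills.Theorems.UnitScaleTiltProp7CompetitorEnergyMember
import Summits.QuantumFields.YangMills.Theorems.UnitScaleTiltProp7BubbleOnBlocks
import HarnessLib

/-!
# Route `UnitScaleTilt`, crux K1 «MinimiserStabilityRegPr» (stmt-QuantumFields-19200), route-R E′, architecture (A′) «HCOW-VIA-Σ» (★★OWNER RULING g28-№13), package P-A4
# «CRUDE SLICE ON PRINT'S SLICE», CURVED — THE KNIT (px12 g5 word 03:51:44Z «px19 g5: HCOMP-KNIT»): at a printed-regular background `W ∈ 𝔘_k(a)` ([Balaban1985Variational] (2), (6)),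
# ★★ `hcomp_of_regPr` — the COMPETITOR ROW of px12 g5's door ✓ `Prop7DivSqOfCombBernsteinRow.div_sq_le_of_competitorRow`, VERBATIM: every gauge parameter `f` on the torus admits a
# competitor `fC` in its residual comb class (`Q′_{K−n}(W)((fC − f)♯)(y) = 0` at EVERY level-`k` site `y ∈ ℤ³` of the based pullback) with `Σ_bΣ_jk|(D^η_W fC)(b)_jk|² ≤ C_P·Σ_xΣ_jk|f(x)_jk|²`,
# `C_P = 36⁶∕16·(3 + 27a²)` ABSOLUTE (k-, K-, L-uniform); and ★★★ `div_sq_le_of_isLandauPrint_of_regPr` — the crude slice on print's slice at `W`: `‖D*_W X̃‖² ≤ C_P·‖X̃‖²` for every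
# `X` in print's projected Landau gauge `IsLandauPrint F n K W X` — ONE LINE through px12's door.

THE COMPETITOR (Bałaban's bubble, [Balaban1984PropagatorsII] (2.7)–(2.12); the variational reading of P-A4, 19200 evidence #51): `k = K − n ≥ 1`, `ℓ = Lᵏ ≥ 3`, `φ(z) = Π_i r_i(ℓ − 1 − r_i)`,
`r_i = z_i mod ℓ` (✓ `Prop7BubbleOnBlocks`); for each level-`k` site `y`, `M_y X = Q′_k[W♯](φ•R(σ_y)⁻¹X)(y)` with `σ_y` the comb transport from the block corner `Lᵏy` and
`‖M_y − m•1‖ ≤ θ(3,L)·2a·m`, `m = L^{−3k}Σ_{Bᵏ(y)}φ = L^{−3k}(ℓ(ℓ−1)(ℓ−2)∕6)³ > 0` (px11 g5 ✓ `Prop7CombCompetitorPullback.exists_clm_combAvg_axial_of_regPr`); Neumann (✓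
`Prop7BlockCompetitorEnergy.exists_inverse_of_norm_sub_smul_one_le`, window `θ(3,L)·2a ≤ ½`) gives `M_y⁻¹`, `‖M_y⁻¹‖ ≤ 2∕m`; `ν(y) = M_y⁻¹(Q′_k f♯)(y)`,
`G(z) = φ(z)•R(σ_{⌊z∕ℓ⌋}(z))⁻¹ν(⌊z∕ℓ⌋)` and `fC = G ∘ ρ` (`ρ` the cell representative at `basePt`, ✓ `Prop7TorusCellRepr`).  CLAUSE 1: on the period cell `(fC − f)♯ = G − f♯` blockwise, so
`Q′_k((fC − f)♯)(y) = 0` there by px11's exact coset match ✓ `QprimeIter_competitor_sub_eq_zero` + locality ✓ `QprimeIter_congr_of_eqOn_blockSites`; at every other `y ∈ ℤ³` by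
periodicity ✓ `QprimeIter_bgT_add_of_periodic` (background and argument are `N`-periodic, `N = ℓ·N_k`).  CLAUSE 2: ✓ `Prop7CompetitorEnergyMember.competitor_energy_member` fed with the
bubble rows (✓ `Prop7BubbleOnBlocks`: `A₁ = ℓ³(ℓ⁵∕16)²`, `B₁ = (ℓ⁵∕16)³`, mass `≥ (ℓ³∕36)³`), the comb-gauge row (κ) `κ₀ = 2aℓ⁻²` (px11 ✓ F2b
`norm_gaugeAct_axialFn_pull_sub_one_le_of_regPr`), and the datum row `μ₀ = 2∕m` (px11 ✓ `Prop7CombCompetitorPullback.norm_QprimeIter_le_of_le` (v1.1), transporters unitary up to level `k` by w1 ✓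
`Prop7LandauCombDict.bgT_pull_mem_unitaryUnits_of_regPr`, [Balaban1985Averaging] Prop. 2); the powers of `ℓ` cancel exactly: `η⁻²·4(3A₁ + (6ℓκ₀)²·3B₁)·μ₀²·ℓ⁻³ = (3 + 27a²)∕16·(ℓ⁶∕m)² ≤ 36⁶∕16·(3 + 27a²)`.

Cell `ym3-torus`, width seat `ym3-torus-px19` (gen 5).  Pens of record (★★OWNER RULING №16, px12 g5 02:39:52Z ∕ 03:51:44Z): V1 ∕ F1-core ∕ B-β ∕ (b-T) ∕ KNIT = px19; F2 ∕ (b-ℤ) = px11 g5;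
(a) + F3 doors = px12 g5.  THEOREMS ONLY (0 `def`, 0 `sorry`); `--supports stmt-QuantumFields-19200 --as helper`, count-neutral.  HONEST SCOPE: the height hypothesis `n < K` (`k ≥ 1`;
at `k = 0` the comb class is trivial and `fC = f` would need the crude bound `Σ|Df|² ≤ 12Σ|f|²` instead — not typed here); the three windows on `a` are L-only; nothing here
claims `bern_P`, `hcoW`, E′, a registered stub, the crux, d = 4 or the mass gap — YM₃ on T³ is a ladder rung (R3), not the Clay problem.

References: T. Bałaban, CMP 96 (1984) 223–250 [Balaban1984PropagatorsII] (§1, (2.7)–(2.12) pp.224–225); CMP 99 (1985) 389–434 [Balaban1985BackgroundPropagators] ((3.8) p.392,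
(3.18)–(3.23) pp.393–394, (3.42) p.398); CMP 98 (1985) 17–51 [Balaban1985Averaging] ((43) p.24, Prop. 2 (52)–(54) p.26, (78)–(80) p.30); CMP 99 (1985) 75–102
[Balaban1985RegularSpaces] ((1.7) p.77, (1.38) p.82); CMP 102 (1985) 277–309 [Balaban1985Variational] ((2) p.278, (6) p.279, (21) p.281, Prop. 7 p.299).
-/

set_option autoImplicit false

noncomputable section

open scoped BigOperators Matrix.Norms.L2Operator
open Finset

namespace Summit.QuantumFields.YangMills.Theorems.Prop7DivSqCurvedOfRegPr

open Literature.MathematicalPhysics.QuantumFieldTheory.Balaban1983to89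
open Literature.MathematicalPhysics.QuantumFieldTheory.Balaban1983to89.T3ContinuumYM3Torus
open Literature.MathematicalPhysics.QuantumFieldTheory.Balaban1983to89.T3PrintedRegularMinimiser (RegPr)
open B7Prop1Explicit renaming Site → LSite
open B7Prop1Explicit (e e_apply l1 U1 axialFn gaugeAct)
open B7Prop2Explicit (C0 c2' unitaryUnits_le_U1)
open B7Eq78Linearization (conjR QprimeIter zdBlocking)
open B8Eq119TwistedAxial (bgT)
open B10Eq27TorusAxialLog (transl transl_apply pull pull_apply)
open B12Ineq417Flat (shiftCfg shiftCfg_apply)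
open T3SectALandauChart (covDerivFwdT bgUnits eta eta_pos)
open Literature.MathematicalPhysics.QuantumLattice (blockMap blockBase blockSites mem_blockSites_iff card_blockSites)
open Summit.QuantumFields.YangMills.Theorems.Prop7SPrint (basePt IsLandauPrint)
open Summit.QuantumFields.YangMills.Theorems.Prop7SectET3HilbertLetters (toL2 DstarL2)
open Summit.QuantumFields.YangMills.Theorems.Prop7TorusCellRepr (cellRepr_transl_of_mem_cell)
open Summit.QuantumFields.YangMills.Theorems.Prop7LandauCombDict (isPeriodic_pull isPeriodic_comp_transl pow_dvd_sitesPerDir_zero bgT_pull_mem_unitaryUnits_of_regPr)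
open Summit.QuantumFields.YangMills.Theorems.Prop7CombDefectRowsOfRegPr (norm_gaugeAct_axialFn_pull_sub_one_le_of_regPr)
open Summit.QuantumFields.YangMills.Theorems.Prop7CombCompetitorPullback (QprimeIter_congr_of_eqOn_blockSites QprimeIter_bgT_add_of_periodic QprimeIter_competitor_sub_eq_zero
  exists_clm_combAvg_axial_of_regPr norm_QprimeIter_le_of_le)
open Summit.QuantumFields.YangMills.Theorems.Prop7BlockCompetitorEnergy (exists_inverse_of_norm_sub_smul_one_le)
open Summit.QuantumFields.YangMills.Theorems.Prop7BubbleOnBlocks (bubbleZ_nonneg bubbleZ_eq_zero_of_boundary sum_blockSites_bubbleZ blockMassRoot_ge sum_blockSites_bubbleZ_sq_le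
  sum_blockSites_bubbleZ_succ_sub_sq_le)
open Summit.QuantumFields.YangMills.Theorems.Prop7CompetitorEnergyMember (competitor_energy_member)
open Summit.QuantumFields.YangMills.Theorems.Prop7DivSqOfCombBernsteinRow (div_sq_le_of_competitorRow)

/-! ## §1 Two lattice facts: the block of a cell label lies in the cell; every level-`k` site is a cell label plus a period -/

/-- The `ℓ`-block of a label `y` with `0 ≤ y_i < N_k` lies in the period cell `[0, ℓN_k)ᵈ`. [cite: Balaban1987RG1, (0.1) p.251] -/
theorem mem_cell_of_blockMap_eq {d ℓ : ℕ} (hℓ : 0 < ℓ) {Nk : ℤ} (z y : LSite d) (hz : blockMap ℓ z = y) (hy : ∀ i, 0 ≤ y i ∧ y i < Nk) (i : Fin d) :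
    0 ≤ z i ∧ z i < (ℓ : ℤ) * Nk := by
  have hℓZ : (0 : ℤ) < ℓ := by exact_mod_cast hℓ
  have hzi : z i / (ℓ : ℤ) = y i := by
    have := congr_fun hz i
    simpa only [blockMap] using this
  constructor
  · by_contra hneg
    rw [not_le] at hneg
    have : z i / (ℓ : ℤ) < 0 := Int.ediv_neg_of_neg_of_pos hneg hℓZ
    linarith [(hy i).1]
  · have h1 : z i < (ℓ : ℤ) * (z i / (ℓ : ℤ) + 1) := by
      have := Int.lt_mul_ediv_self_add (x := z i) hℓZ
      linarith
    have h2 : z i / (ℓ : ℤ) + 1 ≤ Nk := by rw [hzi]; have := (hy i).2; omega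
    calc z i < (ℓ : ℤ) * (z i / (ℓ : ℤ) + 1) := h1
      _ ≤ (ℓ : ℤ) * Nk := by gcongr

/-- Every `y ∈ ℤᵈ` is `y₀ + N_k•t` with `0 ≤ (y₀)_i < N_k` (`y₀ = y mod N_k`, `t = ⌊y∕N_k⌋` componentwise). [folklore] -/
theorem eq_emod_add_smul_ediv {d : ℕ} (Nk : ℤ) (y : LSite d) :
    y = (fun i => y i % Nk) + Nk • (fun i => y i / Nk) := by
  funext i
  simp only [Pi.add_apply, Pi.smul_apply, smul_eq_mul]
  rw [Int.emod_def]
  ring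

/-- ★ **THE CONSTANT** (pure algebra): with `x = ℓ = Lᵏ`, bubble rows `A₁ = x³(x⁵∕16)²`, `B₁ = (x⁵∕16)³`, comb row `κ₀ = 2a·x⁻²`, datum row `μ₀ = 2∕m`, weight `w = x⁻³`, `η⁻¹ = x`, and the
mass bound `x⁶∕36³ ≤ m`: `η⁻²·4(3A₁ + (2·3xκ₀)²·3B₁)·μ₀²·w = (3 + 27a²)∕16·(x⁶∕m)² ≤ 36⁶∕16·(3 + 27a²)` — every power of `x` cancels. [folklore] -/
theorem energy_constant_le {x m : ℝ} (a : ℝ) (hx : 0 < x) (hm : 0 < m) (hm3 : x ^ 6 / 36 ^ 3 ≤ m) :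
    x ^ 2 * (4 * (3 * (x ^ 3 * (x ^ 5 / 16) ^ 2) + (2 * (3 * x * (2 * a * x⁻¹ ^ 2))) ^ 2 * (3 * (x ^ 5 / 16) ^ 3)) * (2 / m) ^ 2 * (x ^ 3)⁻¹)
      ≤ 36 ^ 6 / 16 * (3 + 27 * a ^ 2) := by
  have hx0 : x ≠ 0 := hx.ne'
  have hm0 : m ≠ 0 := hm.ne'
  have key : x ^ 2 * (4 * (3 * (x ^ 3 * (x ^ 5 / 16) ^ 2) + (2 * (3 * x * (2 * a * x⁻¹ ^ 2))) ^ 2 * (3 * (x ^ 5 / 16) ^ 3)) * (2 / m) ^ 2 * (x ^ 3)⁻¹)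
      = (3 + 27 * a ^ 2) / 16 * (x ^ 6 / m) ^ 2 := by
    field_simp
    ring
  have hq : x ^ 6 / m ≤ 36 ^ 3 := by
    rw [div_le_iff₀ hm]
    have := (div_le_iff₀ (by positivity : (0 : ℝ) < 36 ^ 3)).1 hm3
    linarith
  have hq2 : (x ^ 6 / m) ^ 2 ≤ (36 ^ 3) ^ 2 := pow_le_pow_left₀ (by positivity) hq 2
  rw [key]
  calc (3 + 27 * a ^ 2) / 16 * (x ^ 6 / m) ^ 2 ≤ (3 + 27 * a ^ 2) / 16 * (36 ^ 3) ^ 2 :=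
      mul_le_mul_of_nonneg_left hq2 (by positivity)
    _ = 36 ^ 6 / 16 * (3 + 27 * a ^ 2) := by ring

/-! ## §2 The member: the competitor row at `W ∈ RegPr`, and the crude slice on print's slice -/

section Member

variable (F : T3Family) {n K : ℕ}

/-- ★★ **THE COMPETITOR ROW AT `W ∈ 𝔘_k(a)`** — the hypothesis `hcomp` of px12 g5's ✓ `Prop7DivSqOfCombBernsteinRow.div_sq_le_of_competitorRow`, VERBATIM, with the ABSOLUTE constant
`C_P = 36⁶∕16·(3 + 27a²)`: for `n < K` and the three L-only windows (`C₀(3)·2a ≤ ⅓`, `4a ≤ c₂′(3,L)`: unitary tower transporters; `θ(3,L)·2a ≤ ½`: Neumann for `M_y`), every gauge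
parameter `f` has a competitor `fC` (the bubble competitor of the module docstring) with `Q′_{K−n}(W)((fC − f)♯) = 0` on the whole level-`k` lattice of the based pullback and
`Σ_bΣ_jk|(D^η_W fC)(b)_jk|² ≤ C_P·Σ_xΣ_jk|f(x)_jk|²`.
[cite: Balaban1984PropagatorsII, (2.7)-(2.12) pp.224-225; Balaban1985BackgroundPropagators, (3.18)-(3.23) pp.393-394; Balaban1985Averaging, Prop. 2 (52)-(54) p.26; Balaban1985Variational, (2) p.278, (21) p.281] -/
theorem hcomp_of_regPr {a : ℝ} (ha : 0 < a) (hα3 : C0 (F.P K).d * (2 * a) ≤ 1 / 3) (hα4 : 4 * a ≤ c2' (F.P K).d (F.P K).L)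
    (hαN : (2 * (F.P K).d * (F.P K).L * (256 * ((F.P K).d + 1) * ((F.P K).d + 4) + 1 + (F.P K).d * ((F.P K).L + 1))) * (2 * a) ≤ 1 / 2)
    (hnK : n < K) {W : GaugeField (F.P K) 0 (Matrix.specialUnitaryGroup (Fin 2) ℂ)} (hreg : RegPr F n K a W)
    (f : Site (F.P K) 0 → Matrix (Fin 2) (Fin 2) ℂ) :
    ∃ fC : Site (F.P K) 0 → Matrix (Fin 2) (Fin 2) ℂ,
      (∀ y : LSite (F.P K).d,
        QprimeIter (zdBlocking (F.P K).d (F.P K).L) (bgT (F.P K).L (pull (bgUnits F K W) (basePt F n K))) (K - n)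
          (fun z => (fC - f) (transl (basePt F n K) z)) y = 0) ∧
      ∑ b : PBond (F.P K) 0, ∑ j : Fin 2, ∑ k : Fin 2, ‖(covDerivFwdT (eta F n K) (bgUnits F K W) b.dir fC b.src) j k‖ ^ 2
        ≤ (36 : ℝ) ^ 6 / 16 * (3 + 27 * a ^ 2) * ∑ x : Site (F.P K) 0, ∑ j : Fin 2, ∑ k : Fin 2, ‖f x j k‖ ^ 2 := by
  classical
  -- letters
  set L : ℕ := (F.P K).L with hLdef
  set k : ℕ := K - n with hkdef
  set ℓ : ℕ := L ^ k with hℓdef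
  set x₀ : Site (F.P K) 0 := basePt F n K with hx₀
  set Vt := pull (bgUnits F K W) x₀ with hVt
  set T := bgT L Vt with hTdef
  set w : ℝ := (((L : ℝ) ^ (F.P K).d)⁻¹) ^ k with hw
  have hd3 : (F.P K).d = 3 := rfl
  have hL3 : 3 ≤ L := by
    -- `L` odd and `1 < L` (also ✓ `TubeStart.three_le_PL`, not imported here)
    obtain ⟨c, hc⟩ := F.hL.1
    have h1 := F.hL.2
    show 3 ≤ F.L
    omega
  have hL0 : 0 < L := by omega
  have hk1 : 1 ≤ k := by rw [hkdef]; omega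
  have hℓ3 : 3 ≤ ℓ := by
    rw [hℓdef]
    calc 3 ≤ L := hL3
      _ = L ^ 1 := (pow_one L).symm
      _ ≤ L ^ k := Nat.pow_le_pow_right hL0 hk1
  have hℓ0 : 0 < ℓ := by omega
  haveI : NeZero ℓ := ⟨hℓ0.ne'⟩
  have hℓZ : (0 : ℤ) < ℓ := by exact_mod_cast hℓ0
  have hw0 : 0 < w := by rw [hw]; positivity
  -- the period `N = ℓ·N_k`
  have hdvd : (F.P K).L ^ (K - n) ∣ (F.P K).sitesPerDir 0 := pow_dvd_sitesPerDir_zero F n K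
  obtain ⟨Nk, hNk⟩ := hdvd
  have hN2 : (F.P K).sitesPerDir 0 = 2 * F.L ^ (F.m + K - 0) := rfl
  have h2ℓ : 2 * (F.P K).L ^ (K - n) ≤ (F.P K).sitesPerDir 0 := by
    rw [hN2]
    exact Nat.mul_le_mul_left 2 (Nat.pow_le_pow_right hL0 (by omega))
  -- the bubble
  set φ : LSite (F.P K).d → ℝ := fun z => ∏ i, ((z i % (ℓ : ℤ) : ℤ) : ℝ) * ((ℓ : ℝ) - 1 - ((z i % (ℓ : ℤ) : ℤ) : ℝ)) with hφdef
  have hφ : ∀ z, φ z = ∏ i, ((z i % (ℓ : ℤ) : ℤ) : ℝ) * ((ℓ : ℝ) - 1 - ((z i % (ℓ : ℤ) : ℤ) : ℝ)) := fun z => rfl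
  have hφ0 : ∀ z, 0 ≤ φ z := bubbleZ_nonneg φ hφ hℓ0
  set mroot : ℝ := ∑ j ∈ range ℓ, (j : ℝ) * ((ℓ : ℝ) - 1 - (j : ℝ)) with hmroot
  have hsumφ : ∀ y : LSite (F.P K).d, ∑ x ∈ blockSites ((F.P K).L ^ (K - n)) y, φ x = mroot ^ (F.P K).d := sum_blockSites_bubbleZ φ hφ
  have hmroot3 : (ℓ : ℝ) ^ 3 / 36 ≤ mroot := blockMassRoot_ge hℓ3
  have hmroot0 : 0 < mroot := lt_of_lt_of_le (by positivity) hmroot3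
  set m : ℝ := w * mroot ^ (F.P K).d with hmdef
  have hm0 : 0 < m := mul_pos hw0 (pow_pos hmroot0 _)
  -- the block maps `M_y` and their Neumann inverses
  have hε2 : 2 * (2 * a) ≤ c2' (F.P K).d (F.P K).L := by linarith
  have hM : ∀ y : LSite (F.P K).d, ∃ M : Matrix (Fin 2) (Fin 2) ℂ →L[ℂ] Matrix (Fin 2) (Fin 2) ℂ,
      (∀ X, M X = QprimeIter (zdBlocking (F.P K).d L) T k (fun x => φ x • conjR (axialFn Vt (((L : ℤ) ^ k) • y) x)⁻¹ X) y) ∧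
      ‖M - ((m : ℝ) : ℂ) • (1 : Matrix (Fin 2) (Fin 2) ℂ →L[ℂ] Matrix (Fin 2) (Fin 2) ℂ)‖ ≤ m / 2 := by
    intro y
    obtain ⟨M, h1, h2⟩ := exists_clm_combAvg_axial_of_regPr F n K ha hα3 hε2 hreg x₀ y φ hφ0
    refine ⟨M, h1, ?_⟩
    rw [hsumφ y] at h2
    refine h2.trans ?_
    have := mul_le_mul_of_nonneg_right hαN hm0.le
    calc _ ≤ 1 / 2 * m := this
      _ = m / 2 := by ring
  choose M hMapp hMn using hM
  have hMinvE : ∀ y : LSite (F.P K).d, ∃ Mi : Matrix (Fin 2) (Fin 2) ℂ →L[ℂ] Matrix (Fin 2) (Fin 2) ℂ,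
      (M y).comp Mi = 1 ∧ Mi.comp (M y) = 1 ∧ ‖Mi‖ ≤ 2 / m := fun y => exists_inverse_of_norm_sub_smul_one_le (M y) hm0 (hMn y)
  choose Minv hMinv1 _hMinv2 hMinv3 using hMinvE
  have hMi : ∀ (y : LSite (F.P K).d) (X : Matrix (Fin 2) (Fin 2) ℂ), M y (Minv y X) = X := fun y X => by
    have := DFunLike.congr_fun (hMinv1 y) X
    simpa using this
  -- the datum, the comb transports, the competitor on `ℤ³` and on the torus
  set g : LSite (F.P K).d → Matrix (Fin 2) (Fin 2) ℂ := fun z => f (transl x₀ z) with hgdef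
  set ν : LSite (F.P K).d → Matrix (Fin 2) (Fin 2) ℂ := fun y => Minv y (QprimeIter (zdBlocking (F.P K).d L) T k g y) with hνdef
  set σ : LSite (F.P K).d → LSite (F.P K).d → (Matrix (Fin 2) (Fin 2) ℂ)ˣ := fun y x => axialFn Vt (((L : ℤ) ^ k) • y) x with hσdef
  set G : LSite (F.P K).d → Matrix (Fin 2) (Fin 2) ℂ := fun z => φ z • conjR (σ (blockMap ℓ z) z)⁻¹ (ν (blockMap ℓ z)) with hGdef
  set ρ : Site (F.P K) 0 → LSite (F.P K).d := fun x i => (((x i - x₀ i).val : ℕ) : ℤ) with hρdef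
  have hρ : ∀ (x : Site (F.P K) 0) (i : Fin (F.P K).d), ρ x i = (((x i - x₀ i).val : ℕ) : ℤ) := fun _ _ => rfl
  set fC : Site (F.P K) 0 → Matrix (Fin 2) (Fin 2) ℂ := fun x => G (ρ x) with hfCdef
  refine ⟨fC, ?_, ?_⟩
  · /- CLAUSE 1: `Q′_k((fC − f)♯) = 0` everywhere -/
    -- px11's exact coset match on `ℤ³`
    have hGg : ∀ y : LSite (F.P K).d, QprimeIter (zdBlocking (F.P K).d L) T k (fun z => G z - g z) y = 0 := fun y =>
      QprimeIter_competitor_sub_eq_zero hL0 T k φ σ g (fun y X => Minv y X) ν G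
        (fun y X => (hMapp y (Minv y X)).symm.trans (hMi y X)) (fun _ => rfl) (fun _ => rfl) y
    -- on the period cell `(fC − f)♯ = G − g` blockwise
    have hcell : ∀ y₀ : LSite (F.P K).d, (∀ i, 0 ≤ y₀ i ∧ y₀ i < (Nk : ℤ)) →
        QprimeIter (zdBlocking (F.P K).d L) T k (fun z => (fC - f) (transl x₀ z)) y₀ = 0 := by
      intro y₀ hy₀
      rw [QprimeIter_congr_of_eqOn_blockSites hL0 T k y₀ (h₂ := fun z => G z - g z) ?_]
      · exact hGg y₀
      · intro z hz
        have hzc : ∀ i, 0 ≤ z i ∧ z i < (F.P K).sitesPerDir 0 := by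
          intro i
          have h := mem_cell_of_blockMap_eq hℓ0 z y₀ ((mem_blockSites_iff ℓ _ z).1 hz) hy₀ i
          have hℓZc : ((ℓ : ℕ) : ℤ) = ((F.P K).L : ℤ) ^ (K - n) := by simp only [hℓdef, hLdef, hkdef, Nat.cast_pow]
          rw [hℓZc] at h
          rw [hNk]; push_cast
          exact h
        show fC (transl x₀ z) - f (transl x₀ z) = G z - g z
        rw [show fC (transl x₀ z) = G (ρ (transl x₀ z)) from rfl, cellRepr_transl_of_mem_cell x₀ ρ hρ z hzc]
    -- periodicity in the label: background and argument are `N`-periodic, `N = Lᵏ·N_k`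
    have hper : ∀ y t : LSite (F.P K).d,
        QprimeIter (zdBlocking (F.P K).d L) T k (fun z => (fC - f) (transl x₀ z)) (y + (Nk : ℤ) • t)
          = QprimeIter (zdBlocking (F.P K).d L) T k (fun z => (fC - f) (transl x₀ z)) y := by
      intro y t
      have hsm : ((L : ℤ) ^ k) • ((Nk : ℤ) • t) = (((F.P K).sitesPerDir 0 : ℕ) : ℤ) • t := by
        rw [smul_smul, hNk]; push_cast; rfl
      refine QprimeIter_bgT_add_of_periodic Vt k ((Nk : ℤ) • t) _ ?_ ?_ y
      · funext z; rw [shiftCfg_apply, hsm]; exact isPeriodic_pull (bgUnits F K W) x₀ z t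
      · funext z; rw [shiftCfg_apply, hsm]; exact isPeriodic_comp_transl x₀ (fC - f) z t
    intro y
    have hNk0 : (0 : ℤ) < Nk := by
      have hN0 : 0 < (F.P K).sitesPerDir 0 := lt_of_lt_of_le (by positivity) h2ℓ
      rw [hNk] at hN0
      have hNk0' : 0 < Nk := Nat.pos_of_ne_zero (by rintro rfl; simp at hN0)
      exact_mod_cast hNk0'
    rw [eq_emod_add_smul_ediv (Nk : ℤ) y, hper]
    exact hcell _ fun i => ⟨Int.emod_nonneg _ hNk0.ne', Int.emod_lt_of_pos _ hNk0⟩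
  · /- CLAUSE 2: the energy, by ✓ `competitor_energy_member` -/
    -- unitary transporters up to level `k`, hence the datum row
    have hT1 : ∀ j, j < k → ∀ z x', T j z x' ∈ U1 (Matrix (Fin 2) (Fin 2) ℂ) := fun j hj z x' => by
      letI : CStarAlgebra (Matrix (Fin 2) (Fin 2) ℂ) := B10Eq29TubeLine.cstarAlgebraMatrix 2
      exact unitaryUnits_le_U1 (bgT_pull_mem_unitaryUnits_of_regPr F ha hα3 hα4 hreg j hj.le z x')
    have hμ₀ : (0 : ℝ) ≤ 2 / m := by positivity
    have hν : ∀ y : LSite (F.P K).d, ‖ν y‖ ≤ 2 / m * (w * ∑ z ∈ blockSites ℓ y, ‖f (transl x₀ z)‖) := by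
      intro y
      calc ‖ν y‖ ≤ ‖Minv y‖ * ‖QprimeIter (zdBlocking (F.P K).d L) T k g y‖ := (Minv y).le_opNorm _
        _ ≤ 2 / m * (w * ∑ z ∈ blockSites ℓ y, ‖f (transl x₀ z)‖) :=
            mul_le_mul (hMinv3 y) (norm_QprimeIter_le_of_le hL0 T k hT1 g k le_rfl y) (norm_nonneg _) hμ₀
    -- the comb-gauge row (κ)
    have hκ₀ : (0 : ℝ) ≤ 2 * a * ((((F.P K).L : ℝ) ^ (K - n))⁻¹) ^ 2 := by positivity
    have hκ := norm_gaugeAct_axialFn_pull_sub_one_le_of_regPr F n K ha hreg x₀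
    -- the bubble rows
    have hA₁ : (0 : ℝ) ≤ (ℓ : ℝ) ^ 3 * ((ℓ : ℝ) ^ 5 / 16) ^ ((F.P K).d - 1) := by positivity
    have hB₁ : (0 : ℝ) ≤ ((ℓ : ℝ) ^ 5 / 16) ^ (F.P K).d := by positivity
    have hφbd : ∀ (z : LSite (F.P K).d) (i : Fin (F.P K).d),
        (z i % ((F.P K).L ^ (K - n) : ℕ) = 0 ∨ z i % ((F.P K).L ^ (K - n) : ℕ) = ((F.P K).L ^ (K - n) : ℕ) - 1) → φ z = 0 :=
      fun z i h => bubbleZ_eq_zero_of_boundary φ hφ z i h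
    have hG : ∀ z, G z = φ z • conjR (axialFn Vt ((((F.P K).L ^ (K - n) : ℕ) : ℤ) • blockMap ((F.P K).L ^ (K - n)) z) z)⁻¹
        (ν (blockMap ((F.P K).L ^ (K - n)) z)) := by
      intro z; rw [Nat.cast_pow]
    have hE := competitor_energy_member F n K W hℓ0 ⟨Nk, hNk⟩ h2ℓ ρ hρ φ hφ0 hφbd hA₁ hB₁
      (fun y μ => sum_blockSites_bubbleZ_succ_sub_sq_le φ hφ hℓ0 y μ) (fun y => sum_blockSites_bubbleZ_sq_le φ hφ y) hκ₀ hκ f ν hμ₀ hν G hG fC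
      (fun _ => rfl)
    refine hE.trans (mul_le_mul_of_nonneg_right ?_ (by positivity))
    -- the constant: every power of `ℓ` cancels (`energy_constant_le` at `x := Lᵏ`)
    have hX0 : (0 : ℝ) < ((F.P K).L : ℝ) ^ (K - n) := by positivity
    have hℓX : ((ℓ : ℕ) : ℝ) = ((F.P K).L : ℝ) ^ (K - n) := by simp only [hℓdef, hLdef, hkdef, Nat.cast_pow]
    have hwX : w = ((((F.P K).L : ℝ) ^ (K - n)) ^ 3)⁻¹ := by
      rw [hw, hd3, inv_pow, ← pow_mul, mul_comm 3 k, pow_mul]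
    have hm3 : (((F.P K).L : ℝ) ^ (K - n)) ^ 6 / 36 ^ 3 ≤ m := by
      have hm' : (((F.P K).L : ℝ) ^ (K - n)) ^ 3 / 36 ≤ mroot := by rw [← hℓX]; exact hmroot3
      have h36 : ((((F.P K).L : ℝ) ^ (K - n)) ^ 3 / 36) ^ 3 ≤ mroot ^ 3 := pow_le_pow_left₀ (by positivity) hm' 3
      have hmX : m = ((((F.P K).L : ℝ) ^ (K - n)) ^ 3)⁻¹ * mroot ^ 3 := by rw [hmdef, hwX, hd3]
      have hX3 : (((F.P K).L : ℝ) ^ (K - n)) ^ 3 ≠ 0 := by positivity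
      calc (((F.P K).L : ℝ) ^ (K - n)) ^ 6 / 36 ^ 3 = ((((F.P K).L : ℝ) ^ (K - n)) ^ 3)⁻¹ * ((((F.P K).L : ℝ) ^ (K - n)) ^ 3 / 36) ^ 3 := by
            field_simp
        _ ≤ ((((F.P K).L : ℝ) ^ (K - n)) ^ 3)⁻¹ * mroot ^ 3 := mul_le_mul_of_nonneg_left h36 (by positivity)
        _ = m := hmX.symm
    -- read the constant of ✓ `competitor_energy_member` in the letters of `energy_constant_le`
    have hfin : (eta F n K)⁻¹ ^ 2 * (4 * (((3 : ℕ) : ℝ) * ((((F.P K).L ^ (K - n) : ℕ) : ℝ) ^ 3 * ((((F.P K).L ^ (K - n) : ℕ) : ℝ) ^ 5 / 16) ^ (3 - 1))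
          + (2 * (((3 : ℕ) : ℝ) * (((F.P K).L ^ (K - n) : ℕ) : ℝ) * (2 * a * ((((F.P K).L : ℝ) ^ (K - n))⁻¹) ^ 2))) ^ 2
            * (((3 : ℕ) : ℝ) * (((((F.P K).L ^ (K - n) : ℕ) : ℝ) ^ 5 / 16) ^ 3))) * (2 / m) ^ 2 * (((((F.P K).L : ℝ) ^ 3)⁻¹) ^ (K - n)))
        ≤ 36 ^ 6 / 16 * (3 + 27 * a ^ 2) := by
      have e1 : (eta F n K)⁻¹ = ((F.P K).L : ℝ) ^ (K - n) := by
        show (((F.L : ℝ)⁻¹) ^ (K - n))⁻¹ = _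
        rw [inv_pow, inv_inv]; rfl
      have e2 : ((((F.P K).L ^ (K - n) : ℕ) : ℝ)) = ((F.P K).L : ℝ) ^ (K - n) := Nat.cast_pow _ _
      have e3 : (((((F.P K).L : ℝ) ^ 3)⁻¹) ^ (K - n)) = ((((F.P K).L : ℝ) ^ (K - n)) ^ 3)⁻¹ := by rw [inv_pow, ← pow_mul, mul_comm 3 (K - n), pow_mul]
      have e4 : (3 : ℕ) - 1 = 2 := rfl
      rw [e1, e2, e3, e4, Nat.cast_ofNat]
      exact energy_constant_le a hX0 hm0 hm3
    exact hfin

variable (n K) (c₀ : ℝ) [Fact (0 < c₀)]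

/-- ★★★ **THE CRUDE SLICE ON PRINT'S SLICE AT A PRINTED-REGULAR BACKGROUND** (P-A4 curved, closed): for `n < K`, `W ∈ 𝔘_{K−n}(a)` (`RegPr`) within the three L-only windows, and every
route field `X` in print's projected Landau gauge `IsLandauPrint F n K W X`: `‖D*_W X̃‖² ≤ 36⁶∕16·(3 + 27a²)·‖X̃‖²` (`X̃ = toL2 X`) — px12 g5's door ✓ `div_sq_le_of_competitorRow` at the
competitor row `hcomp_of_regPr`. [cite: Balaban1985Variational, (2) p.278, (21) p.281, Prop. 7 p.299; Balaban1985BackgroundPropagators, (3.8) p.392, (3.21)-(3.23) p.394, (3.42) p.398; Balaban1985RegularSpaces, (1.38) p.82] -/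
theorem div_sq_le_of_isLandauPrint_of_regPr {a : ℝ} (ha : 0 < a) (hα3 : C0 (F.P K).d * (2 * a) ≤ 1 / 3) (hα4 : 4 * a ≤ c2' (F.P K).d (F.P K).L)
    (hαN : (2 * (F.P K).d * (F.P K).L * (256 * ((F.P K).d + 1) * ((F.P K).d + 4) + 1 + (F.P K).d * ((F.P K).L + 1))) * (2 * a) ≤ 1 / 2)
    (hnK : n < K) {W : GaugeField (F.P K) 0 (Matrix.specialUnitaryGroup (Fin 2) ℂ)} (hreg : RegPr F n K a W)
    (X : PBond (F.P K) 0 → Matrix (Fin 2) (Fin 2) ℂ) (hX : IsLandauPrint F n K W X) :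
    ‖DstarL2 F n K c₀ W (toL2 F K c₀ X)‖ ^ 2 ≤ (36 : ℝ) ^ 6 / 16 * (3 + 27 * a ^ 2) * ‖toL2 F K c₀ X‖ ^ 2 :=
  div_sq_le_of_competitorRow F n K c₀ ha hα3 hα4 hreg (by positivity) (hcomp_of_regPr F ha hα3 hα4 hαN hnK hreg) X hX

end Member

end Summit.QuantumFields.YangMills.Theorems.Prop7DivSqCurvedOfRegPr

end
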